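import Mathlib

/-!
# Crux `NewtonTauWeak` (stmt-ValiantsHypothesis-5904), line `low-parallelism`: the CAP REDUCTION
`LowParallelismLaw → CartesianParabolaBound` and the landing form of the law (Theorems-side port, crit-3 VERDICT #12
price P5; part 2 of 2)

Line `Cruxes/NewtonTauWeak/Lines/low_parallelism.lean` (val-idea-12 g2), vocabulary as in part 1
(`NewtonFramesLowParallelismDictionary`): `incTriples A B L = ((A ×ˢ B) ×ˢ L).filter (b = μ a + ν)` (incidences of the
Cartesian product `A × B` with the non-vertical lines `y = μ x + ν`, `(μ, ν) ∈ L`), `landings = incTriples.image (a + μ/2)`,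
`slopeMult L μ = #(L.filter (slope = μ))`; statements are written out over tree-visible constants (no new definitions).

THE LEVER OF THE LINE — THE PARALLELISM CAP.  A landing is determined by (slope, abscissa), so one slope yields `≤ #A ≤ n`
landings however many parallel lines carry it; slopes carrying `> K` lines are `≤ n²/K` in number, hence cost `≤ n³/K`
landings in total, by counting alone.  With `K = (n+2)^{1/3+θ}`:

* §1 landing counts: `card_landings_filter_le` (`#Hv · #A` landings from slopes in `Hv`), `card_landings_le_incTriples`,
  `card_landings_le_add` (splitting `L`), `card_heavy_mul_le` (`#Hv · K ≤ #L` if every slope of `Hv` carries `> K` lines);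
* §2 `capReductionLanding` — the cap reduction for the LANDING form of the law (`≤ C (n+2)^{8/3-θ}`
  landings for line sets with `≤ (n+2)^{1/3+θ}` lines per slope ⇒ `≤ (C+1) (n+2)^{8/3-θ}` landings for EVERY line set,
  i.e. `CartesianParabolaBound` with `η = θ`); `landingLaw_of_law` (landings ≤ incidences); hence
  `capReduction : LowParallelismLaw → CartesianParabolaBound` (`η = θ`, `C ↦ C+1`) — the line's U2, verbatim;
  conversely `landingLaw_of_cartesianParabolaBound`, so `landingLaw_iff_cartesianParabolaBound`: the landing form of
  the law is EQUIVALENT to the Cartesian–parabola rung (calibration for crit-3's price P1, "register the landing form":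
  that form IS `CartesianParabolaBound` with the parallelism reduction built in; only the incidence form
  `LowParallelismLaw` is a strictly new statement).

Everything here is an implication between OPEN statements or an unconditional count; nothing proves
`LowParallelismLaw`, `CartesianParabolaBound`, `ThreeSetBound`, `BeatTwoThirds`, the crux `NewtonTauWeak`, or anything
about `VP ≠ VNP`.  Helper for the crux item (`--supports`); proofs are the line file's rev-2/rev-3 proofs, moved (names as in rev 3:
`capReductionLanding`, `landingLaw_of_law`, `capReduction`, `landingLaw_iff_cartesianParabolaBound`, `parabolaDictionary`).
-/

set_option linter.dupNamespace false

namespace Summit.ValiantsHypothesis.ValiantsHypothesis.Theorems.NewtonFramesNewtonTauWeak.LowParallelism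

open scoped BigOperators Pointwise

noncomputable section

/-! ### 1. Landing counts -/

/-- Landings coming from the lines whose slope lies in `Hv` number at most `#Hv · #A` (a landing is determined by
(slope, abscissa)). [folklore] -/
theorem card_landings_filter_le (A B : Finset ℝ) (L : Finset (ℝ × ℝ)) (Hv : Finset ℝ) :
    ((((A ×ˢ B) ×ˢ (L.filter fun l : ℝ × ℝ => l.1 ∈ Hv)).filter
        fun q : (ℝ × ℝ) × (ℝ × ℝ) => q.1.2 = q.2.1 * q.1.1 + q.2.2).image
          fun q : (ℝ × ℝ) × (ℝ × ℝ) => q.1.1 + q.2.1 / 2).card ≤ Hv.card * A.card := by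
  classical
  have hsub : (((A ×ˢ B) ×ˢ (L.filter fun l : ℝ × ℝ => l.1 ∈ Hv)).filter
        fun q : (ℝ × ℝ) × (ℝ × ℝ) => q.1.2 = q.2.1 * q.1.1 + q.2.2).image
          (fun q : (ℝ × ℝ) × (ℝ × ℝ) => q.1.1 + q.2.1 / 2) ⊆
      Hv.biUnion fun μ => A.image fun a => a + μ / 2 := by
    intro x hx
    simp only [Finset.mem_image, Finset.mem_filter, Finset.mem_product] at hx
    obtain ⟨q, ⟨⟨⟨ha, _⟩, _, hμ⟩, _⟩, rfl⟩ := hx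
    exact Finset.mem_biUnion.2 ⟨q.2.1, hμ, Finset.mem_image.2 ⟨q.1.1, ha, rfl⟩⟩
  calc _ ≤ (Hv.biUnion fun μ => A.image fun a => a + μ / 2).card := Finset.card_le_card hsub
    _ ≤ ∑ μ ∈ Hv, (A.image fun a => a + μ / 2).card := Finset.card_biUnion_le
    _ ≤ ∑ _μ ∈ Hv, A.card := Finset.sum_le_sum fun μ _ => Finset.card_image_le
    _ = Hv.card * A.card := by rw [Finset.sum_const, smul_eq_mul]

/-- Landings are at most incidences. [folklore] -/
theorem card_landings_le_incTriples (A B : Finset ℝ) (L : Finset (ℝ × ℝ)) :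
    ((((A ×ˢ B) ×ˢ L).filter fun q : (ℝ × ℝ) × (ℝ × ℝ) => q.1.2 = q.2.1 * q.1.1 + q.2.2).image
        fun q : (ℝ × ℝ) × (ℝ × ℝ) => q.1.1 + q.2.1 / 2).card ≤
      (((A ×ˢ B) ×ˢ L).filter fun q : (ℝ × ℝ) × (ℝ × ℝ) => q.1.2 = q.2.1 * q.1.1 + q.2.2).card :=
  Finset.card_image_le

/-- Splitting the line set by a predicate splits the landings: `#landings(L) ≤ #landings(L ∩ p) + #landings(L \ p)`.
[folklore] -/
theorem card_landings_le_add (A B : Finset ℝ) (L : Finset (ℝ × ℝ)) (p : ℝ × ℝ → Prop) [DecidablePred p] :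
    ((((A ×ˢ B) ×ˢ L).filter fun q : (ℝ × ℝ) × (ℝ × ℝ) => q.1.2 = q.2.1 * q.1.1 + q.2.2).image
        fun q : (ℝ × ℝ) × (ℝ × ℝ) => q.1.1 + q.2.1 / 2).card ≤
      ((((A ×ˢ B) ×ˢ (L.filter p)).filter fun q : (ℝ × ℝ) × (ℝ × ℝ) => q.1.2 = q.2.1 * q.1.1 + q.2.2).image
          fun q : (ℝ × ℝ) × (ℝ × ℝ) => q.1.1 + q.2.1 / 2).card +
        ((((A ×ˢ B) ×ˢ (L.filter fun l => ¬ p l)).filter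
            fun q : (ℝ × ℝ) × (ℝ × ℝ) => q.1.2 = q.2.1 * q.1.1 + q.2.2).image
          fun q : (ℝ × ℝ) × (ℝ × ℝ) => q.1.1 + q.2.1 / 2).card := by
  classical
  refine le_trans (Finset.card_le_card ?_) (Finset.card_union_le _ _)
  intro x hx
  simp only [Finset.mem_image, Finset.mem_filter, Finset.mem_product] at hx
  obtain ⟨q, ⟨⟨hab, hL⟩, heq⟩, rfl⟩ := hx
  by_cases hp : p q.2
  · refine Finset.mem_union_left _ ?_
    simp only [Finset.mem_image, Finset.mem_filter, Finset.mem_product]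
    exact ⟨q, ⟨⟨hab, hL, hp⟩, heq⟩, rfl⟩
  · refine Finset.mem_union_right _ ?_
    simp only [Finset.mem_image, Finset.mem_filter, Finset.mem_product]
    exact ⟨q, ⟨⟨hab, hL, hp⟩, heq⟩, rfl⟩

/-- The heavy slopes are few: if every slope in `Hv` carries more than `K` lines of `L`, then `#Hv · K ≤ #L` (the slope
classes are disjoint). [folklore] -/
theorem card_heavy_mul_le (L : Finset (ℝ × ℝ)) (K : ℝ) (Hv : Finset ℝ)
    (hHv : ∀ μ ∈ Hv, K < ((L.filter fun l : ℝ × ℝ => l.1 = μ).card : ℝ)) : (Hv.card : ℝ) * K ≤ (L.card : ℝ) := by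
  classical
  have h1 : (Hv.card : ℝ) * K ≤ ∑ μ ∈ Hv, ((L.filter fun l : ℝ × ℝ => l.1 = μ).card : ℝ) := by
    calc (Hv.card : ℝ) * K = ∑ _μ ∈ Hv, K := by rw [Finset.sum_const, nsmul_eq_mul]
      _ ≤ ∑ μ ∈ Hv, ((L.filter fun l : ℝ × ℝ => l.1 = μ).card : ℝ) :=
          Finset.sum_le_sum fun μ hμ => (hHv μ hμ).le
  have h2 : ∑ μ ∈ Hv, (L.filter fun l : ℝ × ℝ => l.1 = μ).card ≤ L.card := by
    rw [← Finset.card_biUnion]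
    · exact Finset.card_le_card (Finset.biUnion_subset.2 fun μ _ => Finset.filter_subset _ _)
    · intro μ _ μ' _ hne
      simp only [Function.onFun]
      rw [Finset.disjoint_filter]
      intro l _ h1 h2
      exact hne (h1.symm.trans h2)
  have h2' : (∑ μ ∈ Hv, ((L.filter fun l : ℝ × ℝ => l.1 = μ).card : ℝ)) ≤ (L.card : ℝ) := by exact_mod_cast h2
  exact h1.trans h2'

/-! ### 2. The cap reduction -/

/-- **THE CAP REDUCTION, landing form.**  If for some `θ > 0`, `C` every line set `L` (`#L ≤ n²`) with at most
`(n+2)^{1/3+θ}` lines per slope produces `≤ C (n+2)^{8/3-θ}` LANDINGS on `A × B` (`#A, #B ≤ n`), then the same bound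
with `C + 1` holds for EVERY line set (`CartesianParabolaBound`, `η = θ`): split `L` at parallelism
`K = (n+2)^{1/3+θ}`; the slopes carrying `> K` lines are `≤ n²/K` in number (`card_heavy_mul_le`) and give `≤ #A ≤ n`
landings each (`card_landings_filter_le`), `n³/K ≤ (n+2)^{8/3-θ}`; the light lines obey the hypothesis. [folklore] -/
theorem capReductionLanding
    (hlaw : ∃ (θ C : ℝ), 0 < θ ∧ ∀ (n : ℕ) (A B : Finset ℝ) (L : Finset (ℝ × ℝ)),
      A.card ≤ n → B.card ≤ n → L.card ≤ n ^ 2 →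
        (∀ μ : ℝ, ((L.filter fun l : ℝ × ℝ => l.1 = μ).card : ℝ) ≤ ((n : ℝ) + 2) ^ ((1 : ℝ) / 3 + θ)) →
          (((((A ×ˢ B) ×ˢ L).filter fun q : (ℝ × ℝ) × (ℝ × ℝ) => q.1.2 = q.2.1 * q.1.1 + q.2.2).image
              fun q : (ℝ × ℝ) × (ℝ × ℝ) => q.1.1 + q.2.1 / 2).card : ℝ) ≤ C * ((n : ℝ) + 2) ^ ((8 : ℝ) / 3 - θ)) :
    ∃ (η C : ℝ), 0 < η ∧ ∀ (n : ℕ) (A B : Finset ℝ) (L : Finset (ℝ × ℝ)),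
      A.card ≤ n → B.card ≤ n → L.card ≤ n ^ 2 →
        (((((A ×ˢ B) ×ˢ L).filter fun q : (ℝ × ℝ) × (ℝ × ℝ) => q.1.2 = q.2.1 * q.1.1 + q.2.2).image
            fun q : (ℝ × ℝ) × (ℝ × ℝ) => q.1.1 + q.2.1 / 2).card : ℝ) ≤ C * ((n : ℝ) + 2) ^ ((8 : ℝ) / 3 - η) := by
  classical
  obtain ⟨θ, C, hθ, hlaw⟩ := hlaw
  refine ⟨θ, C + 1, hθ, ?_⟩
  intro n A B L hA hB hL
  -- local names for the line's objects
  set land : Finset (ℝ × ℝ) → Finset ℝ := fun M =>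
    (((A ×ˢ B) ×ˢ M).filter fun q : (ℝ × ℝ) × (ℝ × ℝ) => q.1.2 = q.2.1 * q.1.1 + q.2.2).image
      fun q : (ℝ × ℝ) × (ℝ × ℝ) => q.1.1 + q.2.1 / 2 with hland
  set mult : Finset (ℝ × ℝ) → ℝ → ℕ := fun M μ => (M.filter fun l : ℝ × ℝ => l.1 = μ).card with hmult
  change ((land L).card : ℝ) ≤ _
  set N : ℝ := (n : ℝ) + 2 with hN
  have hN2 : (2 : ℝ) ≤ N := by rw [hN]; have := (Nat.cast_nonneg n : (0 : ℝ) ≤ n); linarith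
  have hNpos : 0 < N := by linarith
  set K : ℝ := N ^ ((1 : ℝ) / 3 + θ) with hK
  have hKpos : 0 < K := Real.rpow_pos_of_pos hNpos _
  -- light / heavy split of the line set by slope multiplicity
  set light : ℝ × ℝ → Prop := fun l => (mult L l.1 : ℝ) ≤ K with hlight
  set Ll := L.filter light with hLl
  set Lh := L.filter fun l => ¬ light l with hLh
  -- (i) the light part obeys the law
  have hLl_card : Ll.card ≤ n ^ 2 := (Finset.card_filter_le _ _).trans hL
  have hLl_mult : ∀ μ : ℝ, (mult Ll μ : ℝ) ≤ N ^ ((1 : ℝ) / 3 + θ) := by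
    intro μ
    by_cases hμ : (mult L μ : ℝ) ≤ K
    · have : mult Ll μ ≤ mult L μ := by
        simp only [hmult]
        exact Finset.card_le_card (Finset.filter_subset_filter _ (Finset.filter_subset _ _))
      calc (mult Ll μ : ℝ) ≤ mult L μ := by exact_mod_cast this
        _ ≤ K := hμ
    · have h0 : mult Ll μ = 0 := by
        simp only [hmult]
        rw [Finset.card_eq_zero, Finset.filter_eq_empty_iff]
        intro l hl hlμ
        rw [hLl, Finset.mem_filter] at hl
        apply hμ
        rw [← hlμ]
        exact hl.2
      rw [h0]; push_cast; exact (Real.rpow_pos_of_pos hNpos _).le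
  have hland_l : ((land Ll).card : ℝ) ≤ C * N ^ ((8 : ℝ) / 3 - θ) := hlaw n A B Ll hA hB hLl_card hLl_mult
  -- (ii) the heavy part: few slopes, `≤ n` landings each
  set Hv : Finset ℝ := (L.image Prod.fst).filter fun μ => K < (mult L μ : ℝ) with hHv
  have hLh_eq : Lh = L.filter fun l => l.1 ∈ Hv := by
    rw [hLh]
    apply Finset.filter_congr
    intro l hl
    simp only [hlight, not_le, hHv, Finset.mem_filter, Finset.mem_image]
    constructor
    · intro h; exact ⟨⟨l, hl, rfl⟩, h⟩
    · intro h; exact h.2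
  have hHvK : (Hv.card : ℝ) * K ≤ (n : ℝ) ^ 2 := by
    have := card_heavy_mul_le L K Hv (fun μ hμ => (Finset.mem_filter.1 hμ).2)
    refine this.trans ?_
    exact_mod_cast hL
  have hland_h : ((land Lh).card : ℝ) ≤ N ^ ((8 : ℝ) / 3 - θ) := by
    have h1 : ((land Lh).card : ℝ) ≤ (Hv.card : ℝ) * n := by
      rw [hLh_eq]
      have := card_landings_filter_le A B L Hv
      calc ((land (L.filter fun l => l.1 ∈ Hv)).card : ℝ) ≤ (Hv.card : ℝ) * A.card := by
            exact_mod_cast this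
        _ ≤ (Hv.card : ℝ) * n := by
            apply mul_le_mul_of_nonneg_left _ (Nat.cast_nonneg _)
            exact_mod_cast hA
    -- `#Hv · n ≤ n³ / K ≤ N³ / K = N^{8/3 - θ}`
    have hn_le : (n : ℝ) ≤ N := by rw [hN]; linarith
    have hn0 : (0 : ℝ) ≤ n := Nat.cast_nonneg n
    have h2 : (Hv.card : ℝ) * n * K ≤ N ^ (3 : ℝ) := by
      calc (Hv.card : ℝ) * n * K = ((Hv.card : ℝ) * K) * n := by ring
        _ ≤ (n : ℝ) ^ 2 * n := mul_le_mul_of_nonneg_right hHvK hn0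
        _ = (n : ℝ) ^ (3 : ℕ) := by ring
        _ ≤ N ^ (3 : ℕ) := pow_le_pow_left₀ hn0 hn_le 3
        _ = N ^ (3 : ℝ) := by rw [← Real.rpow_natCast]; norm_num
    have h3 : N ^ (3 : ℝ) = N ^ ((8 : ℝ) / 3 - θ) * K := by
      rw [hK, ← Real.rpow_add hNpos]; norm_num
    have h4 : (Hv.card : ℝ) * n ≤ N ^ ((8 : ℝ) / 3 - θ) := by
      rw [h3] at h2
      exact le_of_mul_le_mul_right h2 hKpos
    exact h1.trans h4
  -- (iii) assemble
  have hsplit : (land L).card ≤ (land Ll).card + (land Lh).card := card_landings_le_add A B L light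
  calc ((land L).card : ℝ) ≤ (land Ll).card + (land Lh).card := by exact_mod_cast hsplit
    _ ≤ C * N ^ ((8 : ℝ) / 3 - θ) + N ^ ((8 : ℝ) / 3 - θ) := add_le_add hland_l hland_h
    _ = (C + 1) * N ^ ((8 : ℝ) / 3 - θ) := by ring

/-- The landing form of the law follows from the incidence form (`LowParallelismLaw`), with the same `θ`, `C`:
landings are at most incidences. [folklore] -/
theorem landingLaw_of_law
    (hlaw : ∃ (θ C : ℝ), 0 < θ ∧ ∀ (n : ℕ) (A B : Finset ℝ) (L : Finset (ℝ × ℝ)),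
      A.card ≤ n → B.card ≤ n → L.card ≤ n ^ 2 →
        (∀ μ : ℝ, ((L.filter fun l : ℝ × ℝ => l.1 = μ).card : ℝ) ≤ ((n : ℝ) + 2) ^ ((1 : ℝ) / 3 + θ)) →
          ((((A ×ˢ B) ×ˢ L).filter fun q : (ℝ × ℝ) × (ℝ × ℝ) => q.1.2 = q.2.1 * q.1.1 + q.2.2).card : ℝ) ≤
            C * ((n : ℝ) + 2) ^ ((8 : ℝ) / 3 - θ)) :
    ∃ (θ C : ℝ), 0 < θ ∧ ∀ (n : ℕ) (A B : Finset ℝ) (L : Finset (ℝ × ℝ)),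
      A.card ≤ n → B.card ≤ n → L.card ≤ n ^ 2 →
        (∀ μ : ℝ, ((L.filter fun l : ℝ × ℝ => l.1 = μ).card : ℝ) ≤ ((n : ℝ) + 2) ^ ((1 : ℝ) / 3 + θ)) →
          (((((A ×ˢ B) ×ˢ L).filter fun q : (ℝ × ℝ) × (ℝ × ℝ) => q.1.2 = q.2.1 * q.1.1 + q.2.2).image
              fun q : (ℝ × ℝ) × (ℝ × ℝ) => q.1.1 + q.2.1 / 2).card : ℝ) ≤ C * ((n : ℝ) + 2) ^ ((8 : ℝ) / 3 - θ) := by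
  obtain ⟨θ, C, hθ, hlaw⟩ := hlaw
  refine ⟨θ, C, hθ, fun n A B L hA hB hL hpar => le_trans ?_ (hlaw n A B L hA hB hL hpar)⟩
  exact_mod_cast card_landings_le_incTriples A B L

/-- **THE CAP REDUCTION (U2 of line `low-parallelism`), verbatim:** `LowParallelismLaw → CartesianParabolaBound`
(`η = θ`, `C ↦ C + 1`) — `landingLaw_of_law` then `capReductionLanding`. [folklore] -/
theorem capReduction
    (hlaw : ∃ (θ C : ℝ), 0 < θ ∧ ∀ (n : ℕ) (A B : Finset ℝ) (L : Finset (ℝ × ℝ)),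
      A.card ≤ n → B.card ≤ n → L.card ≤ n ^ 2 →
        (∀ μ : ℝ, ((L.filter fun l : ℝ × ℝ => l.1 = μ).card : ℝ) ≤ ((n : ℝ) + 2) ^ ((1 : ℝ) / 3 + θ)) →
          ((((A ×ˢ B) ×ˢ L).filter fun q : (ℝ × ℝ) × (ℝ × ℝ) => q.1.2 = q.2.1 * q.1.1 + q.2.2).card : ℝ) ≤
            C * ((n : ℝ) + 2) ^ ((8 : ℝ) / 3 - θ)) :
    ∃ (η C : ℝ), 0 < η ∧ ∀ (n : ℕ) (A B : Finset ℝ) (L : Finset (ℝ × ℝ)),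
      A.card ≤ n → B.card ≤ n → L.card ≤ n ^ 2 →
        (((((A ×ˢ B) ×ˢ L).filter fun q : (ℝ × ℝ) × (ℝ × ℝ) => q.1.2 = q.2.1 * q.1.1 + q.2.2).image
            fun q : (ℝ × ℝ) × (ℝ × ℝ) => q.1.1 + q.2.1 / 2).card : ℝ) ≤ C * ((n : ℝ) + 2) ^ ((8 : ℝ) / 3 - η) :=
  capReductionLanding (landingLaw_of_law hlaw)

/-- Conversely the Cartesian–parabola rung gives the landing form of the law (take `θ = η`, ignore the parallelism
hypothesis). [folklore] -/
theorem landingLaw_of_cartesianParabolaBound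
    (h : ∃ (η C : ℝ), 0 < η ∧ ∀ (n : ℕ) (A B : Finset ℝ) (L : Finset (ℝ × ℝ)),
      A.card ≤ n → B.card ≤ n → L.card ≤ n ^ 2 →
        (((((A ×ˢ B) ×ˢ L).filter fun q : (ℝ × ℝ) × (ℝ × ℝ) => q.1.2 = q.2.1 * q.1.1 + q.2.2).image
            fun q : (ℝ × ℝ) × (ℝ × ℝ) => q.1.1 + q.2.1 / 2).card : ℝ) ≤ C * ((n : ℝ) + 2) ^ ((8 : ℝ) / 3 - η)) :
    ∃ (θ C : ℝ), 0 < θ ∧ ∀ (n : ℕ) (A B : Finset ℝ) (L : Finset (ℝ × ℝ)),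
      A.card ≤ n → B.card ≤ n → L.card ≤ n ^ 2 →
        (∀ μ : ℝ, ((L.filter fun l : ℝ × ℝ => l.1 = μ).card : ℝ) ≤ ((n : ℝ) + 2) ^ ((1 : ℝ) / 3 + θ)) →
          (((((A ×ˢ B) ×ˢ L).filter fun q : (ℝ × ℝ) × (ℝ × ℝ) => q.1.2 = q.2.1 * q.1.1 + q.2.2).image
              fun q : (ℝ × ℝ) × (ℝ × ℝ) => q.1.1 + q.2.1 / 2).card : ℝ) ≤ C * ((n : ℝ) + 2) ^ ((8 : ℝ) / 3 - θ) := by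
  obtain ⟨η, C, hη, h⟩ := h
  exact ⟨η, C, hη, fun n A B L hA hB hL _ => h n A B L hA hB hL⟩

/-- **Calibration of the landing form:** the landing form of the low-parallelism law is EQUIVALENT to the
Cartesian–parabola rung `CartesianParabolaBound` (the parallelism hypothesis can be removed at the cost `C ↦ C + 1`, by
the cap reduction). [folklore] -/
theorem landingLaw_iff_cartesianParabolaBound :
    (∃ (θ C : ℝ), 0 < θ ∧ ∀ (n : ℕ) (A B : Finset ℝ) (L : Finset (ℝ × ℝ)),
      A.card ≤ n → B.card ≤ n → L.card ≤ n ^ 2 →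
        (∀ μ : ℝ, ((L.filter fun l : ℝ × ℝ => l.1 = μ).card : ℝ) ≤ ((n : ℝ) + 2) ^ ((1 : ℝ) / 3 + θ)) →
          (((((A ×ˢ B) ×ˢ L).filter fun q : (ℝ × ℝ) × (ℝ × ℝ) => q.1.2 = q.2.1 * q.1.1 + q.2.2).image
              fun q : (ℝ × ℝ) × (ℝ × ℝ) => q.1.1 + q.2.1 / 2).card : ℝ) ≤ C * ((n : ℝ) + 2) ^ ((8 : ℝ) / 3 - θ)) ↔
    (∃ (η C : ℝ), 0 < η ∧ ∀ (n : ℕ) (A B : Finset ℝ) (L : Finset (ℝ × ℝ)),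
      A.card ≤ n → B.card ≤ n → L.card ≤ n ^ 2 →
        (((((A ×ˢ B) ×ˢ L).filter fun q : (ℝ × ℝ) × (ℝ × ℝ) => q.1.2 = q.2.1 * q.1.1 + q.2.2).image
            fun q : (ℝ × ℝ) × (ℝ × ℝ) => q.1.1 + q.2.1 / 2).card : ℝ) ≤ C * ((n : ℝ) + 2) ^ ((8 : ℝ) / 3 - η)) :=
  ⟨capReductionLanding, landingLaw_of_cartesianParabolaBound⟩

end

end Summit.ValiantsHypothesis.ValiantsHypothesis.Theorems.NewtonFramesNewtonTauWeak.LowParallelism
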